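/-
Copyright (c) 2026 the pub-hodgecm-mathlib formalisation cell (harness21).  Prover seat hodgecm-mathlib-R90-IF-p02 (g2), programme R90-TF, section S9 «InnerForm-13.3.6 (c)»,
deal (S5-rows) offer (b) «the (ℓ8)-free reader law `hone` for `oneDimOf := fun ρ h => h.choose`» (R90-IF-plan (g2) 2026-09-04T23:26:53Z; S5 dealer R90-C133-plan (g2) «=» 23:31:33Z).
-/
import Summits.HodgeConjecture.HodgeConjecture.Theorems.R90S5SpectralPacketHOfOneDim   -- ★ p862138 (S5): `R90.S5.IsOneDimH ρ := ∃ ξ, ρ.fin.IsCharPacket (ξ_v) …` (kit-law-free); cone ★ `GlobalPacketH.IsCharPacket`, `SpectralPacketH`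
import Literature.NumberTheory.Rogawski1990.OneDimAutRepHCofiniteRigidity           -- ★ `OneDimAutRepH.ext_of_xiLocalChar_eq_of_not_mem` (strong multiplicity one for the characters of `H`)
import Literature.NumberTheory.Automorphic.SmoothCharacterOfCharacter                  -- ★ `IrrClass.mk_ofChar_eq_mk_ofChar_iff` (one-dimensional classes determine their character)
import HarnessLib

/-!
# R90-TF · S9 «InnerForm-13.3.6 (c)» — THE ξ-READER OF THE RECORD, (ℓ8)-FREE: a one-dimensional spectral `H`-packet `ρ` determines ITS `ξ`
# (`IsOneDimH ρ → ∃! ξ`), so `oneDimOf := fun ρ h => h.choose` reads back the `ξ` of any singleton-packet witness (Rogawski 1990 §13.1 p. 199; §13.3 p. 203; §12.1 p. 171)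

Cell `hodgecm-mathlib`, crux H413 (`stmt-HodgeConjecture-24833`, lane `--supports … --as helper`), route of record `HCCMUnconditional` (no route verbs; count-neutral).
Programme R90-TF (HUMAN RULING «R90-TF SLAB — MAX PUSH»; brief `director/R90-BRIEF.v2.md` 1f40d54518340a35), section S9 = InnerForm-13.3.6 (c) (base `R90-IF`); seat R90-IF-p02 (g2);
deal (S5-rows) of R90-IF-plan (g2) 23:26:53Z, offer (b) of the census `R90/R90-IF-p02/g2/CENSUS-S5rows.p02.md` c599bb407bf0acd1 (readers bundle, conjunct `hone`), S5 dealer «=» 23:31:33Z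
(«`X_cm` with `IsOneDimH := R90.S5.IsOneDimH`, `oneDimOf := fun ρ h => h.choose` «=» from S5 (kit-law-free ★ p862138 tokens)»).  THEOREMS ONLY (no `def`, no instance, no notation,
no named-fact hypothesis, no `sorry`); imports ★ Theorems ∕ ★ Literature only (FILE B ED. 4 imports THIS file).
HONEST LABEL: HC_CM is proved only modulo the 7 printed citations (2 remaining named inputs: hLiu418 = stmt-HodgeConjecture-24832, h413 = stmt-HodgeConjecture-24833) — until
rung 0 closes.  This file proves no printed trace statement: it is the uniqueness half of «`ξ ∈ Π(H)`, `dim ξ = 1`» read on packets — two one-dimensional automorphic `ξ, ξ′` whose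
singleton local packets `{⟦ξ_v⟧}` coincide at every finite place are EQUAL (★ `IrrClass.mk_ofChar_eq_mk_ofChar_iff`: a one-dimensional class determines its character; ★ strong
multiplicity one `OneDimAutRepH.ext_of_xiLocalChar_eq_of_not_mem`, Hecke characters of the norm-one torus agreeing at all finite places are equal) — hence the datum reader
`X_cm.oneDimOf := fun ρ h => h.choose` (B ED. 4 §0) satisfies the READER LAW `hone : X_cm.oneDimOf ρ h₁ = ξ` for EVERY `ρ` whose finite part is the singleton packet family of `ξ`
(the conjunct (ⅲ) of `sock_S9_xiReaders_cm`, IN-FILE, 0 sorry) — WITHOUT the refuted kit pin (ℓ8) `OneDimHLaw` (S5-C2 ED. 2a header :58–:59).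

## Contents (namespace `Summit.HodgeConjecture.HodgeConjecture.R90.S5`, next to ★ `IsOneDimH`; generic kit family `𝔩`, any `DiscH`)
* `eq_of_isCharPacket_of_isCharPacket` — `ρ.IsCharPacket (ξ_v) → ρ.IsCharPacket (ξ′_v) → ξ = ξ′` (on a bare `GlobalPacketH`).
* `IsOneDimH.existsUnique` — `IsOneDimH ρ → ∃! ξ, ρ.fin.IsCharPacket (ξ_v) …`.
* **`IsOneDimH.choose_eq`** — `(h : IsOneDimH ρ) → ρ.fin.IsCharPacket (ξ_v) … → h.choose = ξ` (the reader law `hone` at `oneDimOf := fun ρ h => h.choose`).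

## References
[Rogawski1990] J. D. Rogawski, *Automorphic Representations of Unitary Groups in Three Variables*, Ann. of Math. Stud. 123 (1990): §13.1 p. 199; §13.3 p. 203; §12.1 p. 171; §12.2 p. 174.
[CasselsFrohlichANT1967] J. W. S. Cassels, A. Fröhlich (eds.), *Algebraic Number Theory* (1967), Ch. VII §4 Prop. 4.1 (proof).
-/

set_option autoImplicit false
set_option linter.dupNamespace false  -- the mandated namespace repeats the summit's segment (`HodgeConjecture.HodgeConjecture`)

noncomputable section

open NumberField IsDedekindDomain MeasureTheory
open scoped Matrix
open Literature.NumberTheory Literature.NumberTheory.Automorphic Literature.NumberTheory.Automorphic.UnitaryGroup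
open Literature.NumberTheory.Rogawski1990 Literature.NumberTheory.GaloisRepresentations
open Summit.HodgeConjecture.HodgeConjecture.Cruxes.H413
open Summit.HodgeConjecture.HodgeConjecture.Cruxes.H413.F0P3LocalPacketKit
open Summit.HodgeConjecture.HodgeConjecture.Cruxes.H413.F0P3GlobalPacket
open Summit.HodgeConjecture.HodgeConjecture.Cruxes.H413.F0P3ArchPacketKit
open Summit.HodgeConjecture.HodgeConjecture.Cruxes.H413.F0P3SpectralPacket

namespace Summit.HodgeConjecture.HodgeConjecture.R90.S5

section OneDimReader

variable {L : Type} [Field L] [NumberField L] [IsCMField L] {H' : Matrix (Fin 3) (Fin 3) L}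
  {𝔩 : ∀ v : HeightOneSpectrum (𝓞 ↥(maximalRealSubfield L)), LocalPacketKit L H' v} {𝔞 : ArchPacketKit} {𝔞H : ArchPacketKitH 𝔞}
  {DiscH : GlobalPacketH 𝔩 → 𝔞H.PktInfH → Prop}

/-- **Two one-dimensional automorphic `ξ, ξ′` with the same singleton local packets everywhere are equal**: `{⟦ξ_v⟧} = {⟦ξ′_v⟧}` gives `ξ_v = ξ′_v` (★ a one-dimensional class
determines its character), at every finite `v`, hence `ξ = ξ′` (★ strong multiplicity one for the characters of `H = U(2) × U(1)`). [cite: Rogawski1990, §13.1 p. 199; §12.2 p. 174]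
[cite: CasselsFrohlichANT1967, Ch. VII §4 Prop. 4.1 (proof)] -/
theorem eq_of_isCharPacket_of_isCharPacket {σ : GlobalPacketH 𝔩} {ξ ξ' : OneDimAutRepH L}
    (h : σ.IsCharPacket (fun v => ξ.xiLocalChar v) (fun v => F0P3XiLocalCharOpenKernel.isOpen_ker_xiLocalChar L ξ v))
    (h' : σ.IsCharPacket (fun v => ξ'.xiLocalChar v) (fun v => F0P3XiLocalCharOpenKernel.isOpen_ker_xiLocalChar L ξ' v)) : ξ = ξ' := by
  refine OneDimAutRepH.ext_of_xiLocalChar_eq_of_not_mem ∅ fun v _ => ?_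
  have hv := (h v).symm.trans (h' v)
  exact (IrrClass.mk_ofChar_eq_mk_ofChar_iff _ _).1 (Finset.singleton_injective hv)

/-- **`IsOneDimH ρ → ∃! ξ`**: the one-dimensional `ξ` underlying a one-dimensional spectral `H`-packet is UNIQUE. [cite: Rogawski1990, §13.3 p. 203; §13.1 p. 199] -/
theorem IsOneDimH.existsUnique {ρ : SpectralPacketH 𝔩 𝔞 𝔞H DiscH} (h : IsOneDimH ρ) :
    ∃! ξ : OneDimAutRepH L, ρ.fin.IsCharPacket (fun v => ξ.xiLocalChar v) (fun v => F0P3XiLocalCharOpenKernel.isOpen_ker_xiLocalChar L ξ v) := by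
  obtain ⟨ξ, hξ⟩ := h
  exact ⟨ξ, hξ, fun ξ' hξ' => eq_of_isCharPacket_of_isCharPacket hξ' hξ⟩

/-- **THE READER LAW `hone` FOR `oneDimOf := fun ρ h => h.choose`** (B ED. 4 §0's `X_cm` parameter, (ℓ8)-free): for every one-dimensionality witness `h : IsOneDimH ρ` and every `ξ`
whose singleton packets are `ρ`'s finite part, `h.choose = ξ` — conjunct (ⅲ) of `sock_S9_xiReaders_cm` IN-FILE. [cite: Rogawski1990, §13.3 p. 203; §13.1 p. 199; §12.1 p. 171] -/
theorem IsOneDimH.choose_eq {ρ : SpectralPacketH 𝔩 𝔞 𝔞H DiscH} (h : IsOneDimH ρ) {ξ : OneDimAutRepH L}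
    (hξ : ρ.fin.IsCharPacket (fun v => ξ.xiLocalChar v) (fun v => F0P3XiLocalCharOpenKernel.isOpen_ker_xiLocalChar L ξ v)) : h.choose = ξ :=
  eq_of_isCharPacket_of_isCharPacket h.choose_spec hξ

end OneDimReader

end Summit.HodgeConjecture.HodgeConjecture.R90.S5

end
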